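import Summits.MatrixMultiplication.MatrixMultiplication.Theorems.SoloInformedSliceRank
import Literature.Computability.AlgebraicComplexity.KoszulFlatteningBorderRank
import Literature.Barriers.ValiantsHypothesis.BIJL18BorderRankSlicesProofs

/-!
# The slice-rank transfer lemma: a degeneration with a square first matrix cannot raise the minimal slice rank

Solo seat `solo-MatrixMultiplication-informed` (generation 38); second of three files voiding the
Kronecker-catalytic door D11' (`matrixMultiplication_of_cwTensor_two_kroneckerCatalyst`).

**Transfer lemma** (`exists_slice_rank_le_of_isApproxRestriction`, every field `K`).  Let
`t ⊴_h s` be a degeneration in coordinates (BCS (15.19)): polynomial matrices `A(ε), B(ε), C(ε)`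
with `(A(ε) ⊗ B(ε) ⊗ C(ε)) s = εʰ t + O(ε^{h+1})`, and suppose the first index sets of `s` and `t`
have THE SAME cardinality (`e : ι' ≃ ι`, so `A(ε)` is square).  Then for every non-zero functional
`α₀` on the first factor of `s` there is a non-zero functional `β₀` on the first factor of `t` with

  `rank t(β₀) ≤ rank s(α₀)`.

Proof.  Over the domain `K[ε]` a square matrix `A(ε)ᵀ` has, for the column `α₀`, a non-zero
polynomial vector `β(ε)` and a scalar `δ(ε)` with `A(ε)ᵀ β(ε) = δ(ε) α₀` (`β = adj(Aᵀ) α₀`,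
`δ = det A` if `det A ≠ 0`; a kernel vector and `δ = 0` otherwise; `exists_mulVec_eq_smul`).
Contracting the first index of `(A ⊗ B ⊗ C) s` against `β(ε)` gives the polynomial matrix
`P(ε) = δ(ε) · B(ε) s(α₀) C(ε)ᵀ`, of rank `≤ rank_K s(α₀)` over `K(ε)`; on the other side, with
`β(ε) = ε^d (β₀ + ε β₁)`, `β₀ ≠ 0` (`d` the least trailing degree), `P(ε) = ε^{d+h} (t(β₀) + ε M₁)`,
so `rank_K t(β₀) ≤ rank_{K(ε)} P(ε)` by the tree's algebraic semicontinuity of rank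
(`rank_le_rank_map_of_perturbation`, `KoszulFlatteningBorderRank.lean`; base change of rank
`Prop19.rank_map_le_rank`, `BIJL18BorderRankSlicesProofs.lean`).

HONEST FRAMING: the classical fact that degeneration cannot increase the generic slice corank when
the first formats agree (Landsberg 2017, §5.2.1, equations from bounded-rank slice spaces; Strassen
1988, §3 for degenerations), made algebraic over an arbitrary field so that no topology is needed.

[cite: BurgisserClausenShokrollahi1997, (15.19)]
[cite: Landsberg2017, Prop. 5.2.1.2]
[cite: Strassen1988, §3]
-/

set_option linter.dupNamespace false
set_option linter.unusedSectionVars false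

noncomputable section

namespace Summit.MatrixMultiplication.MatrixMultiplication.Theorems

open Literature.Computability.AlgebraicComplexity
open scoped BigOperators Polynomial Matrix
open Polynomial

namespace SliceRank

variable {K : Type*} [Field K]

/-! ## Linear algebra over a domain: `M w = δ v` with `w ≠ 0` -/

/-- Over a domain, for a square matrix `M` and a non-zero vector `v` there are `w ≠ 0` and a scalar
`δ` with `M w = δ v`: `w = adj(M) v`, `δ = det M` when `det M ≠ 0`, and a kernel vector with `δ = 0`
otherwise. [cite: HornJohnson2013, §0.8.2] -/
theorem exists_mulVec_eq_smul {R : Type*} [CommRing R] [IsDomain R] {n : Type*} [Fintype n]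
    [DecidableEq n] (M : Matrix n n R) {v : n → R} (hv : v ≠ 0) :
    ∃ (w : n → R) (δ : R), w ≠ 0 ∧ M *ᵥ w = δ • v := by
  by_cases hdet : M.det = 0
  · obtain ⟨w, hw0, hw⟩ := Matrix.exists_mulVec_eq_zero_iff.2 hdet
    exact ⟨w, 0, hw0, by rw [hw, zero_smul]⟩
  · have hmul : M *ᵥ (M.adjugate *ᵥ v) = M.det • v := by
      rw [Matrix.mulVec_mulVec, Matrix.mul_adjugate, Matrix.smul_mulVec, Matrix.one_mulVec]
    refine ⟨M.adjugate *ᵥ v, M.det, fun hw => hv (funext fun a => ?_), hmul⟩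
    have := congr_fun hmul a
    rw [hw, Matrix.mulVec_zero] at this
    have h' : M.det * v a = 0 := by simpa using this.symm
    exact (mul_eq_zero.1 h').resolve_left hdet

/-! ## Polynomials: lowest coefficients -/

/-- A polynomial whose coefficients below degree `n` vanish and whose degree-`n` coefficient is `τ`
is `(τ + ε q) εⁿ`. [folklore] -/
theorem exists_eq_mul_X_pow_of_coeff {p : K[X]} {n : ℕ} {τ : K} (hlow : ∀ j < n, p.coeff j = 0)
    (hn : p.coeff n = τ) : ∃ q : K[X], p = (C τ + X * q) * X ^ n := by
  obtain ⟨p', hp'⟩ : X ^ n ∣ p := Polynomial.X_pow_dvd_iff.2 hlow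
  refine ⟨p'.divX, ?_⟩
  have h0 : p'.coeff 0 = τ := by
    rw [← hn, hp', Polynomial.coeff_X_pow_mul']
    simp
  calc p = X ^ n * p' := hp'
    _ = X ^ n * (X * p'.divX + C (p'.coeff 0)) := by rw [Polynomial.X_mul_divX_add]
    _ = (C τ + X * p'.divX) * X ^ n := by rw [h0]; ring

/-- Lowest coefficients of a product `f · E` when `f = O(ε^d)` and `E = τ εʰ + O(ε^{h+1})`: the
product is `O(ε^{d+h})` with coefficient `f[d] τ` in degree `d + h`. [folklore] -/
theorem coeff_mul_of_low {f E : K[X]} {d h : ℕ} {τ : K} (hf : ∀ e < d, f.coeff e = 0)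
    (hE : ∀ j ≤ h, E.coeff j = if j = h then τ else 0) :
    (∀ j < d + h, (f * E).coeff j = 0) ∧ (f * E).coeff (d + h) = f.coeff d * τ := by
  constructor
  · intro j hj
    rw [Polynomial.coeff_mul]
    refine Finset.sum_eq_zero fun x hx => ?_
    rw [Finset.HasAntidiagonal.mem_antidiagonal] at hx
    by_cases hi : x.1 < d
    · rw [hf x.1 hi, zero_mul]
    · rw [hE x.2 (by omega), if_neg (by omega), mul_zero]
  · rw [Polynomial.coeff_mul, Finset.sum_eq_single (d, h)]
    · rw [hE h le_rfl, if_pos rfl]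
    · intro x hx hne
      rw [Finset.HasAntidiagonal.mem_antidiagonal] at hx
      by_cases hi : x.1 < d
      · rw [hf x.1 hi, zero_mul]
      · rw [hE x.2 (by omega), if_neg, mul_zero]
        intro h2
        apply hne
        refine Prod.ext ?_ h2
        show x.1 = d
        omega
    · intro hmem
      exact (hmem (Finset.HasAntidiagonal.mem_antidiagonal.2 rfl)).elim

/-! ## The transfer lemma -/

section Transfer

variable {ι κ μ ι' κ' μ' : Type*} [Fintype ι] [Fintype κ] [Fintype μ] [Fintype ι'] [Fintype κ']
  [Fintype μ']

/-- **Slice-rank transfer under a degeneration with a square first matrix.**  If `t ⊴_h s` via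
`(A(ε), B(ε), C(ε))` and the first index sets of `t` and `s` are in bijection, then for every
non-zero `α₀` there is a non-zero `β₀` with `rank t(β₀) ≤ rank s(α₀)`.
[cite: BurgisserClausenShokrollahi1997, (15.19)] [cite: Landsberg2017, Prop. 5.2.1.2] -/
theorem exists_slice_rank_le_of_isApproxRestriction {h : ℕ} {s : ι → κ → μ → K}
    {t : ι' → κ' → μ' → K} {Am : ι' → ι → K[X]} {Bm : κ' → κ → K[X]} {Cm : μ' → μ → K[X]}
    (hd : IsApproxRestriction h s t Am Bm Cm) (e : ι' ≃ ι) {α₀ : ι → K} (hα : α₀ ≠ 0) :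
    ∃ β₀ : ι' → K, β₀ ≠ 0 ∧ (slice t β₀).rank ≤ (slice s α₀).rank := by
  classical
  -- (1) `A(ε)ᵀ β(ε) = δ(ε) α₀` with `β ≠ 0`
  have hαh : (fun a => C (α₀ a) : ι → K[X]) ≠ 0 := by
    intro h0
    exact hα (funext fun a => by simpa using congr_fun h0 a)
  obtain ⟨w, δ, hw0, hw⟩ :=
    exists_mulVec_eq_smul (Matrix.of fun a a'' => Am (e.symm a'') a) hαh
  obtain ⟨β, hβ⟩ : ∃ β : ι' → K[X], ∀ a', β a' = w (e a') := ⟨_, fun _ => rfl⟩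
  have hβ0 : β ≠ 0 := by
    intro h0
    exact hw0 (funext fun a => by simpa [hβ] using congr_fun h0 (e.symm a))
  have hAβ : ∀ a, ∑ a', β a' * Am a' a = δ * C (α₀ a) := by
    intro a
    have := congr_fun hw a
    simp only [Matrix.mulVec, dotProduct, Matrix.of_apply, Pi.smul_apply, smul_eq_mul] at this
    rw [← this, ← e.sum_comp]
    simp [hβ, mul_comm]
  -- (2) the least trailing degree `d` of `β` and the lowest coefficient vector `β₀ ≠ 0`
  obtain ⟨x₀, hx₀⟩ : ∃ a', β a' ≠ 0 := by
    by_contra hne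
    simp only [not_exists, not_not] at hne
    exact hβ0 (funext hne)
  obtain ⟨x₁, hx₁, hmin⟩ := Finset.exists_min_image (Finset.univ.filter fun x => β x ≠ 0)
    (fun x => (β x).natTrailingDegree) ⟨x₀, by simpa using hx₀⟩
  rw [Finset.mem_filter] at hx₁
  set d := (β x₁).natTrailingDegree with hd_def
  have hlow : ∀ x, ∀ e' < d, (β x).coeff e' = 0 := by
    intro x e' he
    by_cases hx : β x = 0
    · rw [hx, coeff_zero]
    · exact coeff_eq_zero_of_lt_natTrailingDegree (he.trans_le (hmin x (by simpa using hx)))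
  obtain ⟨β₀, hβ₀def⟩ : ∃ β₀ : ι' → K, ∀ a', β₀ a' = (β a').coeff d := ⟨_, fun _ => rfl⟩
  have hβ₀ : β₀ ≠ 0 := by
    intro h0
    have : (β x₁).trailingCoeff = 0 := by
      have := congr_fun h0 x₁
      rwa [Pi.zero_apply, hβ₀def] at this
    exact hx₁.2 (trailingCoeff_eq_zero.1 this)
  -- (3) the contracted polynomial matrix `P(ε) = ∑_{a'} β_{a'} ((A ⊗ B ⊗ C) s)_{a',·,·}`
  obtain ⟨Pm, hPm⟩ : ∃ Pm : Matrix κ' μ' K[X], ∀ b' c', Pm b' c' =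
      ∑ a', β a' * ∑ a, ∑ b, ∑ c, Am a' a * Bm b' b * Cm c' c * C (s a b c) :=
    ⟨Matrix.of fun b' c' => _, fun _ _ => rfl⟩
  -- (3a) its lowest coefficients: `P = ε^{d+h} (t(β₀) + ε M₁)`
  have hlowP : ∀ b' c', ∀ j < d + h, (Pm b' c').coeff j = 0 := by
    intro b' c' j hj
    rw [hPm, finsetSum_coeff]
    exact Finset.sum_eq_zero fun a' _ => (coeff_mul_of_low (hlow a') (hd a' b' c')).1 j hj
  have htopP : ∀ b' c', (Pm b' c').coeff (d + h) = slice t β₀ b' c' := by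
    intro b' c'
    rw [hPm, finsetSum_coeff, slice_apply]
    exact Finset.sum_congr rfl fun a' _ => by
      rw [(coeff_mul_of_low (hlow a') (hd a' b' c')).2, hβ₀def]
  have hfact : ∀ b' c', ∃ q : K[X], Pm b' c' = (C (slice t β₀ b' c') + X * q) * X ^ (d + h) :=
    fun b' c' => exists_eq_mul_X_pow_of_coeff (hlowP b' c') (htopP b' c')
  choose M₁ hM₁ using hfact
  have hlhs : (slice t β₀).rank ≤ (Pm.map (algebraMap K[X] (FractionRing K[X]))).rank :=
    rank_le_rank_map_of_perturbation (slice t β₀) (Matrix.of fun b' c' => M₁ b' c') Pm (d + h)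
      fun b' c' => hM₁ b' c'
  -- (3b) the other side: `P = (δ B) · s(α₀) · Cᵀ`
  have hR : ∀ b' c', Pm b' c' = ∑ b, ∑ c, δ * Bm b' b * Cm c' c * C (slice s α₀ b c) := by
    intro b' c'
    have hL : Pm b' c' =
        ∑ c, ∑ b, ∑ a, δ * C (α₀ a) * (Bm b' b * Cm c' c * C (s a b c)) := by
      rw [hPm]
      simp only [Finset.mul_sum]
      rw [sum_rev₄]
      refine Finset.sum_congr rfl fun c _ => Finset.sum_congr rfl fun b _ =>
        Finset.sum_congr rfl fun a _ => ?_
      rw [← hAβ a, Finset.sum_mul]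
      refine Finset.sum_congr rfl fun a' _ => ?_
      ring
    rw [hL, Finset.sum_comm]
    refine Finset.sum_congr rfl fun b _ => Finset.sum_congr rfl fun c _ => ?_
    rw [slice_apply, map_sum, Finset.mul_sum]
    refine Finset.sum_congr rfl fun a _ => ?_
    rw [map_mul]
    ring
  set φ := algebraMap K[X] (FractionRing K[X]) with hφ
  have hfacL : Pm.map φ = ((Matrix.of fun b' b => φ (δ * Bm b' b)) *
      (slice s α₀).map (φ.comp C)) * (Matrix.of fun c c' => φ (Cm c' c)) := by
    ext b' c'
    simp only [Matrix.map_apply, Matrix.mul_apply, Matrix.of_apply, RingHom.comp_apply, hR b' c',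
      map_sum, map_mul]
    rw [Finset.sum_comm]
    refine Finset.sum_congr rfl fun c _ => ?_
    rw [Finset.sum_mul]
    refine Finset.sum_congr rfl fun b _ => ?_
    ring
  have hrhs : (Pm.map φ).rank ≤ (slice s α₀).rank := by
    rw [hfacL]
    calc ((Matrix.of fun b' b => φ (δ * Bm b' b)) * (slice s α₀).map (φ.comp C) *
            (Matrix.of fun c c' => φ (Cm c' c))).rank
          ≤ ((Matrix.of fun b' b => φ (δ * Bm b' b)) * (slice s α₀).map (φ.comp C)).rank :=
            Matrix.rank_mul_le_left _ _
      _ ≤ ((slice s α₀).map (φ.comp C)).rank := Matrix.rank_mul_le_right _ _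
      _ ≤ (slice s α₀).rank :=
        Literature.Barriers.ValiantsHypothesis.Prop19.rank_map_le_rank _ _
  exact ⟨β₀, hβ₀, hlhs.trans hrhs⟩

/-- The transfer lemma for a degeneration `t ⊴ s` (some order, some matrices) between tensors whose
first index sets are in bijection: the minimal rank of a non-zero slice of `t` is at most the rank
of any non-zero slice of `s`. [cite: BurgisserClausenShokrollahi1997, (15.19)] -/
theorem exists_slice_rank_le_of_algDegeneratesTo {s : ι → κ → μ → K} {t : ι' → κ' → μ' → K}
    (hst : AlgDegeneratesTo s t) (e : ι' ≃ ι) {α₀ : ι → K} (hα : α₀ ≠ 0) :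
    ∃ β₀ : ι' → K, β₀ ≠ 0 ∧ (slice t β₀).rank ≤ (slice s α₀).rank := by
  obtain ⟨h, Am, Bm, Cm, hd⟩ := hst
  exact exists_slice_rank_le_of_isApproxRestriction hd e hα

/-- **No degeneration raises the minimal slice rank at equal first format**: if `t ⊴ s`, the first
index sets are in bijection, every non-zero slice of `t` has rank `≥ k`, and `s` has a non-zero
slice of rank `< k`, contradiction. [cite: Landsberg2017, Prop. 5.2.1.2] -/
theorem not_algDegeneratesTo_of_minSliceRank {s : ι → κ → μ → K} {t : ι' → κ' → μ' → K} {k : ℕ}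
    (ht : MinSliceRank t k) (e : ι' ≃ ι) {α₀ : ι → K} (hα : α₀ ≠ 0)
    (hs : (slice s α₀).rank < k) : ¬ AlgDegeneratesTo s t := by
  intro hst
  obtain ⟨β₀, hβ₀, hle⟩ := exists_slice_rank_le_of_algDegeneratesTo hst e hα
  exact absurd ((ht β₀ hβ₀).trans hle) (not_le.2 hs)

end Transfer

end SliceRank

end Summit.MatrixMultiplication.MatrixMultiplication.Theorems

end
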